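import Literature.NumberTheory.ModularForms.SiegelThetaCharacteristicPermutationSign
import Literature.NumberTheory.ModularForms.SiegelModularGroupDegreeTwoCommutator
import Mathlib.GroupTheory.SpecificGroups.Alternating
import HarnessLib

/-!
# `Sp₄(𝔽₂) ≅ S₆` through the action of `Γ₂` on the six odd theta characteristics; Reiner's `Γ_4' = π⁻¹(A_6)`

F. Dalla Piazza, B. van Geemen, *Siegel modular forms and finite symplectic groups*, Adv. Theor. Math. Phys. 13
(2009) [arXiv:0804.3769], §1.2 (held text `paper:arxiv-0804.3769`, p0004 L39–L52), verbatim: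
> In particular, `|Sp(2g)| = 6, 6! = 720, 36·(8!)` for `g = 1, 2, 3`. The group `Sp(2g)` acts … non-linearly on the
> (theta) characteristics … It has two orbits on the characteristics, of length `2^{g-1}(2^g+1)` and
> `2^{g-1}(2^g-1)` respectively, the first orbit consists of the even characteristics … the other orbit are the odd
> characteristics. One has the following description of `Sp(2g)` for small `g`: … the action of `Γ_4` on the six
> odd characteristics (for `g = 2`) induces an isomorphism `Sp(4) ≅ S_6`.

I. Reiner, *Real linear characters of the symplectic modular group*, Proc. AMS 6 (1955), §1 (Selected Works p. 93):
> Let `H` be the normal subgroup of `Γ_{2n}` consisting of all matrices `≡ I^{(2n)} (mod 2)`. Then it is known [4]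
> that `Γ_{2n}/H ≅ S_{3n}` for `n = 1, 2`, where `S_k` is the symmetric group on `k` symbols. Let `π` be the
> homomorphism mapping `Γ_{2n}` onto `S_{3n}`, and let `A_{3n}` be the alternating subgroup of `S_{3n}`. Then
> `π⁻¹(A_{3n})` is a subgroup of index `2` of `Γ_{2n}`, `n = 1, 2`.
and §3: "`Γ_4` contains a subgroup `K` of index `2`. Since `Γ_4' ⊂ K`, we then have `Γ_4' = K`." (`[4]` = L. E.
Dickson, *Linear groups*, Teubner 1901.)

Lane `lit-hodgefound`, prover seat p25, row g33-#5; sequel of `SiegelThetaCharacteristicPermutationSign.lean`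
(g32-#9: the sign of `γ_M` on the ten EVEN characteristics is Klingen's `v`) and
`SiegelModularGroupDegreeTwoCommutator.lean` (g33-#2: `Γ₂' = ker v`), on the tree's action
`symplecticCharAction : Sp_{2g}(ℤ) →* 𝔖((ℤ/2)^{2g})` (`SiegelTorusThetaCharacteristicActionHom`; kernel `Γ_g(2)`,
`…Orbits`, `…ModTwo`: `reduceModTwo : Sp_{2g}(ℤ) →* Sp_{2g}(ℤ/2)` onto). Definitions (reviewed): the odd
characteristics `OddChar n`, the restricted action `oddCharAction`, its descent `oddCharActionModTwo` to
`Sp₄(ℤ/2)`, and the isomorphisms `spFourModTwoMulEquivPermOddChar`, `spFourModTwoMulEquivPermFin`; no named fact.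

## What is proved (namespace `Literature.NumberTheory.ModularForms`)

* §1 (every `g`) `OddChar g` — the odd characteristics `(ε, δ) ∈ (ℤ/2)^{2g}`, `Σ εᵢδᵢ = 1`; **`oddCharAction`** —
  `γ` restricted to them, a homomorphism `Sp_{2g}(ℤ) →* 𝔖(OddChar g)` (the parity is `γ`-invariant, tree);
  `card_oddChar_two : |OddChar 2| = 6`.
* §2 (`g = 2`) **faithfulness modulo `2`**: `γ_M` is affine over `𝔽₂`, so `γ_M(a + b + c) = γ_M a + γ_M b + γ_M c`,
  and every characteristic of genus `2` is a sum of three odd ones; hence `γ_M` fixes every characteristic as soon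
  as it fixes the six odd ones (`symplecticCharAction_eq_one_of_oddCharAction_eq_one`), and
  `ker_oddCharAction_eq_ker_reduceModTwo` (`= Γ₂(2)`).
* §3 (`g = 2`) **surjectivity onto `S_6`**: each of the `15` transpositions of the odd characteristics is `γ_w` for
  an explicit word `w` of length `≤ 3` in the translations `n(E₁₁), n(E₂₂), n(e), n(1+e)`, their transposes
  `v(·)` and the rotations `m(T), m(ᵗT)` (`T = (1 1; 0 1)`, `e = (0 1; 1 0)`) — a finite check done by the kernel
  (`decide`); transpositions generate (`Equiv.Perm.closure_isSwap`): `oddCharAction_surjective`.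
* §4 **`Sp₄(ℤ/2) ≅ S₆`**: `oddCharActionModTwo` (the descent through `reduceModTwo`, onto and one-to-one),
  **`spFourModTwoMulEquivPermOddChar : Sp₄(ℤ/2) ≃* 𝔖(OddChar 2)`**, **`spFourModTwoMulEquivPermFin :
  Sp₄(ℤ/2) ≃* Equiv.Perm (Fin 6)`**, `card_symplecticGroup_zmod_two : |Sp₄(ℤ/2)| = 720`,
  `index_ker_reduceModTwo_two : [Γ₂ : Γ₂(2)] = 720`.
* §5 **Reiner's `K`**: `thetaCharacter_eq_sign_oddCharAction` (Klingen's `v(M)` is ALSO the sign of `γ_M` on the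
  six odd characteristics), **`commutator_eq_comap_alternatingGroup`** — `Γ₂' = π⁻¹(A_6)` for
  `π = oddCharAction : Γ₂ → S_6` — and `mem_commutator_iff_sign_oddCharAction_eq_one`.

## References

* [DallaPiazzaVanGeemen2009] F. Dalla Piazza, B. van Geemen, *Siegel modular forms and finite symplectic groups*,
  Adv. Theor. Math. Phys. 13 (2009) 1771–1814, arXiv:0804.3769, §1.2 (p0004 of the held text), §8.4–8.5
  (transvections act as transpositions).
* [Reiner1955RealLinearCharacters] I. Reiner, *Real linear characters of the symplectic modular group*, Proc.
  Amer. Math. Soc. 6 (1955), 987–990, §1 and §3.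
* [Klingen1990] H. Klingen, *Introductory Lectures on Siegel Modular Forms*, CUP (1990), §9 p. 111 (the
  character `v`).
-/

noncomputable section

open Matrix
open Literature.Geometry.Kaehler.ComplexTorus
open Literature.RepresentationTheory.HeisenbergGroup.SymplecticMatrix (unip coe_unip low coe_low levi coe_levi)

namespace Literature.NumberTheory.ModularForms

/-! ### §1 The odd characteristics and the action of `Γ_g` on them -/

section OddCharacteristics

variable {n : ℕ}

/-- **The odd theta characteristics of genus `g`**: the `(ε, δ) ∈ (ℤ/2)^{2g}` (`ε = q ∘ inl`, `δ = q ∘ inr`) with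
`Σᵢ εᵢδᵢ ≠ 0`, i.e. `= 1` — "the other orbit are the odd characteristics", `2^{g-1}(2^g-1)` of them.
[cite: DallaPiazzaVanGeemen2009, §1.2 (p0004 of the held text)] -/
abbrev OddChar (n : ℕ) : Type :=
  {q : Fin n ⊕ Fin n → ZMod 2 // ¬ ∑ i, q (Sum.inl i) * q (Sum.inr i) = 0}

/-- **The action of `Γ_g = Sp_{2g}(ℤ)` on the odd characteristics**: the tree's permutation action `γ` on all
`2^{2g}` characteristics preserves the parity (`sum_mul_symplecticCharPerm_eq_zero_iff`), hence restricts to a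
homomorphism `Sp_{2g}(ℤ) →* 𝔖(odd characteristics)` ("the action of `Γ_4` on the six odd characteristics").
[cite: DallaPiazzaVanGeemen2009, §1.2 (p0004 of the held text)] -/
def oddCharAction : Matrix.symplecticGroup (Fin n) ℤ →* Equiv.Perm (OddChar n) where
  toFun M := (symplecticCharAction M).subtypePerm fun q => not_congr (sum_mul_symplecticCharPerm_eq_zero_iff M.2 q)
  map_one' := by
    ext q
    simp
  map_mul' M N := by
    ext q
    simp [Equiv.Perm.subtypePerm_apply]

/-- Unfolding: `oddCharAction M` acts on an odd characteristic by `γ_M`.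
[cite: DallaPiazzaVanGeemen2009, §1.2 (p0004 of the held text)] -/
theorem oddCharAction_apply_coe (M : Matrix.symplecticGroup (Fin n) ℤ) (q : OddChar n) :
    ((oddCharAction M q : OddChar n) : Fin n ⊕ Fin n → ZMod 2) = symplecticCharAction M q := rfl

/-- **There are six odd characteristics in genus two** (`2^{g-1}(2^g - 1) = 6`).
[cite: DallaPiazzaVanGeemen2009, §1.2 (p0004), Appendix A (p0020 of the held text)] -/
theorem card_oddChar_two : Fintype.card (OddChar 2) = 6 := by
  decide

end OddCharacteristics

/-! ### §2 Genus two: the action on the odd characteristics is faithful modulo `2` -/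

section Faithful

variable {n : ℕ}

/-- In `ℤ/2`, `t + t = 0`. [folklore] -/
private theorem zmod_two_add_self (t : ZMod 2) : t + t = 0 := by
  have h : ∀ t : ZMod 2, t + t = 0 := by decide
  exact h t

/-- **`γ_M` is affine over `𝔽₂`**: `γ_M(a + b + c) = γ_M a + γ_M b + γ_M c` for any three characteristics
(`γ_M p = A p + s` and `3s = s` modulo `2`). [cite: DallaPiazzaVanGeemen2009, §1.2 and §8.5 (p0004, p0021 of the held text)] -/
theorem symplecticCharAction_add_add (M : Matrix.symplecticGroup (Fin n) ℤ) (a b c : Fin n ⊕ Fin n → ZMod 2) :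
    symplecticCharAction M (a + b + c) =
      symplecticCharAction M a + symplecticCharAction M b + symplecticCharAction M c := by
  simp only [symplecticCharAction_apply, symplecticCharPerm_apply, Matrix.mulVec_add]
  funext s
  simp only [Pi.add_apply]
  have h := zmod_two_add_self ((charActionShift (M : Matrix (Fin n ⊕ Fin n) (Fin n ⊕ Fin n) ℤ) s : ℤ) : ZMod 2)
  linear_combination -h

/-- Every characteristic of genus `2` is a sum of three odd characteristics (a finite check).
[folklore] -/
private theorem exists_eq_odd_add_odd_add_odd :
    ∀ p : Fin 2 ⊕ Fin 2 → ZMod 2, ∃ a b c : OddChar 2,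
      p = (a : Fin 2 ⊕ Fin 2 → ZMod 2) + (b : Fin 2 ⊕ Fin 2 → ZMod 2) + (c : Fin 2 ⊕ Fin 2 → ZMod 2) := by
  decide

/-- **Faithfulness on the odd characteristics (`g = 2`)**: if `γ_M` fixes the six odd characteristics it fixes
all sixteen. [cite: DallaPiazzaVanGeemen2009, §1.2 (p0004 of the held text)] -/
theorem symplecticCharAction_eq_one_of_oddCharAction_eq_one (M : Matrix.symplecticGroup (Fin 2) ℤ)
    (h : oddCharAction M = 1) : symplecticCharAction M = 1 := by
  have hfix : ∀ q : OddChar 2, symplecticCharAction M q = q := fun q => by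
    have := congrArg (fun σ : Equiv.Perm (OddChar 2) => ((σ q : OddChar 2) : Fin 2 ⊕ Fin 2 → ZMod 2)) h
    simpa [oddCharAction_apply_coe] using this
  ext p : 1
  obtain ⟨a, b, c, rfl⟩ := exists_eq_odd_add_odd_add_odd p
  rw [symplecticCharAction_add_add, hfix a, hfix b, hfix c, Equiv.Perm.coe_one, id_eq]

/-- **The kernel of the action on the six odd characteristics is `Γ₂(2)`** (the kernel of reduction mod `2`).
[cite: DallaPiazzaVanGeemen2009, §1.2–1.3 (p0004 of the held text)] -/
theorem ker_oddCharAction_eq_ker_reduceModTwo : (oddCharAction (n := 2)).ker = (reduceModTwo 2).ker := by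
  rw [← ker_symplecticCharAction_eq_ker_reduceModTwo]
  ext M
  simp only [MonoidHom.mem_ker]
  refine ⟨symplecticCharAction_eq_one_of_oddCharAction_eq_one M, fun h => Equiv.ext fun q => Subtype.ext ?_⟩
  change ((symplecticCharAction M) q : Fin 2 ⊕ Fin 2 → ZMod 2) = q
  rw [h, Equiv.Perm.coe_one, id_eq]

/-- `γ_M | odd = γ_{M'} | odd` iff `M ≡ M' (mod 2)`. [cite: DallaPiazzaVanGeemen2009, §1.2–1.3 (p0004 of the held text)] -/
theorem oddCharAction_eq_iff_reduceModTwo_eq (M M' : Matrix.symplecticGroup (Fin 2) ℤ) :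
    oddCharAction M = oddCharAction M' ↔ reduceModTwo 2 M = reduceModTwo 2 M' := by
  rw [← inv_mul_eq_one, ← inv_mul_eq_one (a := reduceModTwo 2 M), ← map_inv, ← map_mul, ← map_inv, ← map_mul,
    ← MonoidHom.mem_ker, ← MonoidHom.mem_ker, ker_oddCharAction_eq_ker_reduceModTwo]

end Faithful

/-! ### §3 Genus two: every transposition of the odd characteristics is a `γ_M` — the action is onto `S_6` -/

section Onto

/-- `E₁₁` is symmetric. [folklore] -/
private theorem isSymm_E11 : (!![1, 0; 0, 0] : Matrix (Fin 2) (Fin 2) ℤ).IsSymm := by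
  change (!![1, 0; 0, 0] : Matrix (Fin 2) (Fin 2) ℤ)ᵀ = _; ext i j; fin_cases i <;> fin_cases j <;> rfl

/-- `E₂₂` is symmetric. [folklore] -/
private theorem isSymm_E22 : (!![0, 0; 0, 1] : Matrix (Fin 2) (Fin 2) ℤ).IsSymm := by
  change (!![0, 0; 0, 1] : Matrix (Fin 2) (Fin 2) ℤ)ᵀ = _; ext i j; fin_cases i <;> fin_cases j <;> rfl

/-- `e = E₁₂ + E₂₁` is symmetric. [folklore] -/
private theorem isSymm_e : (!![0, 1; 1, 0] : Matrix (Fin 2) (Fin 2) ℤ).IsSymm := by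
  change (!![0, 1; 1, 0] : Matrix (Fin 2) (Fin 2) ℤ)ᵀ = _; ext i j; fin_cases i <;> fin_cases j <;> rfl

/-- `1 + e` is symmetric. [folklore] -/
private theorem isSymm_ones : (!![1, 1; 1, 1] : Matrix (Fin 2) (Fin 2) ℤ).IsSymm := by
  change (!![1, 1; 1, 1] : Matrix (Fin 2) (Fin 2) ℤ)ᵀ = _; ext i j; fin_cases i <;> fin_cases j <;> rfl

/-- `T = (1 1; 0 1) ∈ GL₂(ℤ)`. [folklore] -/
private def unitT : GL (Fin 2) ℤ :=
  ⟨!![1, 1; 0, 1], !![1, -1; 0, 1], by ext i j; fin_cases i <;> fin_cases j <;> rfl,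
    by ext i j; fin_cases i <;> fin_cases j <;> rfl⟩

/-- `ᵗT = (1 0; 1 1) ∈ GL₂(ℤ)`. [folklore] -/
private def unitTt : GL (Fin 2) ℤ :=
  ⟨!![1, 0; 1, 1], !![1, 0; -1, 1], by ext i j; fin_cases i <;> fin_cases j <;> rfl,
    by ext i j; fin_cases i <;> fin_cases j <;> rfl⟩

/-- The translation `n(E₁₁)`. [folklore] -/
private def n11 : Matrix.symplecticGroup (Fin 2) ℤ := unip !![1, 0; 0, 0] isSymm_E11
/-- The translation `n(E₂₂)`. [folklore] -/
private def n22 : Matrix.symplecticGroup (Fin 2) ℤ := unip !![0, 0; 0, 1] isSymm_E22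
/-- The translation `n(e)`. [folklore] -/
private def n12 : Matrix.symplecticGroup (Fin 2) ℤ := unip !![0, 1; 1, 0] isSymm_e
/-- The translation `n(1 + e)`. [folklore] -/
private def nA : Matrix.symplecticGroup (Fin 2) ℤ := unip !![1, 1; 1, 1] isSymm_ones
/-- The opposite translation `v(E₁₁)`. [folklore] -/
private def l11 : Matrix.symplecticGroup (Fin 2) ℤ := low !![1, 0; 0, 0] isSymm_E11
/-- The opposite translation `v(E₂₂)`. [folklore] -/
private def l22 : Matrix.symplecticGroup (Fin 2) ℤ := low !![0, 0; 0, 1] isSymm_E22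
/-- The opposite translation `v(1 + e)`. [folklore] -/
private def lA : Matrix.symplecticGroup (Fin 2) ℤ := low !![1, 1; 1, 1] isSymm_ones
/-- The rotation `m(T)`. [folklore] -/
private def mT : Matrix.symplecticGroup (Fin 2) ℤ := levi unitT
/-- The rotation `m(ᵗT)`. [folklore] -/
private def mTt : Matrix.symplecticGroup (Fin 2) ℤ := levi unitTt

/-- Fifteen words in the generators, one for each transposition of the six odd characteristics (found by a
search over words of length `≤ 3`; the symplectic transvections, cf. Dalla Piazza–van Geemen §8.4–8.5).
[folklore] -/
private def transpositionWords : List (Matrix.symplecticGroup (Fin 2) ℤ) :=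
  [n11, n12 * lA * n12, n11 * lA * n11, l11, l11 * nA * l11, n22 * lA * n22, lA, n11 * l11 * n11,
    n22 * l11 * mTt, n22, l22 * nA * l22, l22, n11 * l22 * mT, n22 * l22 * n22, nA]

set_option maxHeartbeats 4000000 in
/-- **Every transposition of the six odd characteristics is realised** by one of the fifteen words (checked by
the kernel). [cite: DallaPiazzaVanGeemen2009, §8.4–8.5 (p0020–p0021 of the held text)] -/
private theorem eq_or_exists_oddCharAction_eq_swap :
    ∀ x y : OddChar 2, x = y ∨ ∃ M ∈ transpositionWords, oddCharAction M = Equiv.swap x y := by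
  decide

/-- **`n(E₁₁)` acts on the six odd characteristics as a transposition** (hence with sign `-1`).
[cite: DallaPiazzaVanGeemen2009, §8.5 (p0021 of the held text)] -/
theorem isSwap_oddCharAction_unip_single :
    (oddCharAction (unip (!![1, 0; 0, 0] : Matrix (Fin 2) (Fin 2) ℤ) isSymm_E11)).IsSwap := by
  have h : ∃ x y : OddChar 2, x ≠ y ∧
      oddCharAction (unip (!![1, 0; 0, 0] : Matrix (Fin 2) (Fin 2) ℤ) isSymm_E11) = Equiv.swap x y := by
    decide
  exact h

/-- **Every transposition of the odd characteristics is in the image of `Γ₂`.**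
[cite: DallaPiazzaVanGeemen2009, §1.2, §8.4–8.5 (p0004, p0020–p0021 of the held text)] -/
theorem swap_mem_range_oddCharAction {x y : OddChar 2} (hxy : x ≠ y) :
    Equiv.swap x y ∈ (oddCharAction (n := 2)).range := by
  rcases eq_or_exists_oddCharAction_eq_swap x y with h | ⟨M, -, hM⟩
  · exact absurd h hxy
  · exact ⟨M, hM⟩

/-- **The action of `Γ₂` on the six odd characteristics is onto the full symmetric group** (transpositions
generate). [cite: DallaPiazzaVanGeemen2009, §1.2 (p0004 of the held text)] -/
theorem range_oddCharAction_eq_top : (oddCharAction (n := 2)).range = ⊤ := by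
  rw [eq_top_iff, ← Equiv.Perm.closure_isSwap, Subgroup.closure_le]
  rintro σ ⟨x, y, hxy, rfl⟩
  exact swap_mem_range_oddCharAction hxy

/-- Surjectivity, as a function statement. [cite: DallaPiazzaVanGeemen2009, §1.2 (p0004 of the held text)] -/
theorem oddCharAction_surjective : Function.Surjective (oddCharAction (n := 2)) :=
  MonoidHom.range_eq_top.1 range_oddCharAction_eq_top

end Onto

/-! ### §4 `Sp₄(ℤ/2) ≅ S₆` -/

section Iso

/-- **The action of `Sp₄(ℤ/2) = Γ₂/Γ₂(2)` on the six odd characteristics**: the descent of `oddCharAction`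
through the (surjective) reduction `Γ₂ → Sp₄(ℤ/2)`, whose kernel `Γ₂(2)` acts trivially.
[cite: DallaPiazzaVanGeemen2009, §1.2–1.3 (p0004 of the held text)] -/
def oddCharActionModTwo : Matrix.symplecticGroup (Fin 2) (ZMod 2) →* Equiv.Perm (OddChar 2) :=
  (reduceModTwo 2).liftOfSurjective reduceModTwo_surjective
    ⟨oddCharAction, ker_oddCharAction_eq_ker_reduceModTwo.symm.le⟩

/-- `oddCharActionModTwo (M mod 2) = oddCharAction M`. [cite: DallaPiazzaVanGeemen2009, §1.2–1.3 (p0004 of the held text)] -/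
theorem oddCharActionModTwo_reduceModTwo (M : Matrix.symplecticGroup (Fin 2) ℤ) :
    oddCharActionModTwo (reduceModTwo 2 M) = oddCharAction M :=
  MonoidHom.liftOfRightInverse_comp_apply _ _ _ _ M

/-- **`Sp₄(ℤ/2) → S_6` is a bijection.** [cite: DallaPiazzaVanGeemen2009, §1.2 (p0004 of the held text)] -/
theorem oddCharActionModTwo_bijective : Function.Bijective (oddCharActionModTwo) := by
  refine ⟨fun A B hAB => ?_, fun σ => ?_⟩
  · obtain ⟨a, rfl⟩ := reduceModTwo_surjective A
    obtain ⟨b, rfl⟩ := reduceModTwo_surjective B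
    rw [oddCharActionModTwo_reduceModTwo, oddCharActionModTwo_reduceModTwo] at hAB
    exact (oddCharAction_eq_iff_reduceModTwo_eq a b).1 hAB
  · obtain ⟨M, rfl⟩ := oddCharAction_surjective σ
    exact ⟨reduceModTwo 2 M, oddCharActionModTwo_reduceModTwo M⟩

/-- **`Sp₄(ℤ/2) ≅ 𝔖(six odd characteristics)`** — "the action of `Γ_4` on the six odd characteristics induces an
isomorphism `Sp(4) ≅ S_6`". [cite: DallaPiazzaVanGeemen2009, §1.2 (p0004 of the held text)]
[cite: Reiner1955RealLinearCharacters, §1] -/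
def spFourModTwoMulEquivPermOddChar : Matrix.symplecticGroup (Fin 2) (ZMod 2) ≃* Equiv.Perm (OddChar 2) :=
  MulEquiv.ofBijective oddCharActionModTwo oddCharActionModTwo_bijective

/-- Transport of permutations along a bijection, as a group isomorphism. [folklore] -/
private def permMulEquiv {α β : Type*} (e : α ≃ β) : Equiv.Perm α ≃* Equiv.Perm β where
  toEquiv := e.permCongr
  map_mul' p q := by
    ext x
    simp [Equiv.permCongr_apply]

/-- **`Sp₄(𝔽₂) ≅ S₆`** (Reiner's "`Γ_4/H ≅ S_6`", `[4]` = Dickson): composing with a numbering of the six odd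
characteristics. [cite: Reiner1955RealLinearCharacters, §1] [cite: DallaPiazzaVanGeemen2009, §1.2 (p0004 of the held text)] -/
def spFourModTwoMulEquivPermFin : Matrix.symplecticGroup (Fin 2) (ZMod 2) ≃* Equiv.Perm (Fin 6) :=
  spFourModTwoMulEquivPermOddChar.trans (permMulEquiv (Fintype.equivFinOfCardEq card_oddChar_two))

/-- **`|Sp₄(𝔽₂)| = 720`.** [cite: DallaPiazzaVanGeemen2009, §1.2 (p0004 L39 of the held text)] -/
theorem card_symplecticGroup_zmod_two : Nat.card (Matrix.symplecticGroup (Fin 2) (ZMod 2)) = 720 := by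
  rw [Nat.card_congr spFourModTwoMulEquivPermFin.toEquiv, Nat.card_eq_fintype_card, Fintype.card_perm,
    Fintype.card_fin]
  rfl

/-- **`[Γ₂ : Γ₂(2)] = 720`.** [cite: DallaPiazzaVanGeemen2009, §1.2–1.3 (p0004 of the held text)] -/
theorem index_ker_reduceModTwo_two : (reduceModTwo 2).ker.index = 720 := by
  rw [← ker_symplecticCharAction_eq_ker_reduceModTwo, index_ker_symplecticCharAction, card_symplecticGroup_zmod_two]

/-- `Γ₂ → S_6` is onto `𝔖(Fin 6)` as well (composite with the numbering). [cite: Reiner1955RealLinearCharacters, §1] -/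
theorem permMulEquiv_comp_oddCharAction_surjective :
    Function.Surjective (spFourModTwoMulEquivPermFin.toMonoidHom.comp (reduceModTwo 2)) :=
  spFourModTwoMulEquivPermFin.surjective.comp reduceModTwo_surjective

end Iso

/-! ### §5 Reiner's `K = π⁻¹(A_6)`: the sign of the permutation of the odd characteristics is `v`, and `Γ₂' = K` -/

section ReinerK

/-- The `ℂ`-valued character `M ↦ sgn(γ_M | odd)`. [folklore] -/
private def signOddChar : Matrix.symplecticGroup (Fin 2) ℤ →* ℂ :=
  ((Int.castRingHom ℂ).toMonoidHom.comp (Units.coeHom ℤ)).comp (Equiv.Perm.sign.comp (oddCharAction (n := 2)))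

/-- Unfolding of `signOddChar`. [folklore] -/
private theorem signOddChar_apply (M : Matrix.symplecticGroup (Fin 2) ℤ) :
    signOddChar M = ((Equiv.Perm.sign (oddCharAction M) : ℤˣ) : ℤ) := rfl

/-- `sgn(γ_{n(E₁₁)} | odd) = -1`: the character `sgn(γ | odd)` is non-trivial. [folklore] -/
private theorem signOddChar_ne_one : signOddChar ≠ 1 := by
  intro h
  have h1 := DFunLike.congr_fun h (unip (!![1, 0; 0, 0] : Matrix (Fin 2) (Fin 2) ℤ) isSymm_E11)
  rw [signOddChar_apply, MonoidHom.one_apply, isSwap_oddCharAction_unip_single.sign_eq] at h1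
  norm_num at h1

/-- **Klingen's `v` is the sign of the permutation of the six ODD characteristics too**: `M ↦ sgn(γ_M | odd)` is a
non-trivial character of `Γ₂`, hence equal to `v` ("only one non-trivial character exists"; on the ten even
characteristics: `thetaCharacter_eq_sign_symplecticCharAction`). [cite: Klingen1990, §9 p. 111; §4 p. 59]
[cite: Reiner1955RealLinearCharacters, §1] -/
theorem thetaCharacter_eq_sign_oddCharAction (M : Matrix.symplecticGroup (Fin 2) ℤ) :
    thetaCharacter M = ((Equiv.Perm.sign (oddCharAction M) : ℤˣ) : ℤ) := by
  rcases eq_one_or_eq_thetaCharacter signOddChar with h | h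
  · exact absurd h signOddChar_ne_one
  · rw [← h, signOddChar_apply]

/-- `M ∈ Γ₂'` iff `γ_M` permutes the odd characteristics evenly. [cite: Reiner1955RealLinearCharacters, §1, §3] -/
theorem mem_commutator_iff_sign_oddCharAction_eq_one (M : Matrix.symplecticGroup (Fin 2) ℤ) :
    M ∈ commutator (Matrix.symplecticGroup (Fin 2) ℤ) ↔ Equiv.Perm.sign (oddCharAction M) = 1 := by
  rw [SiegelModularGroupTwo.mem_commutator_iff_thetaCharacter_eq_one, thetaCharacter_eq_sign_oddCharAction]
  rcases Int.units_eq_one_or (Equiv.Perm.sign (oddCharAction M)) with h | h <;> rw [h] <;> norm_num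

/-- **Reiner: `Γ_4' = K = π⁻¹(A_6)`** — the commutator subgroup of `Γ₂ = Sp₄(ℤ)` is the preimage of the
alternating group under `π : Γ₂ → S_6`, the action on the six odd theta characteristics.
[cite: Reiner1955RealLinearCharacters, §1, §3] -/
theorem commutator_eq_comap_alternatingGroup :
    commutator (Matrix.symplecticGroup (Fin 2) ℤ) = (alternatingGroup (OddChar 2)).comap (oddCharAction (n := 2)) := by
  ext M
  rw [Subgroup.mem_comap, Equiv.Perm.mem_alternatingGroup, mem_commutator_iff_sign_oddCharAction_eq_one]

/-- **`π⁻¹(A_6)` has index `2` in `Γ₂`** (Reiner §1: "`π⁻¹(A_{3n})` is a subgroup of index `2` of `Γ_{2n}`").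
[cite: Reiner1955RealLinearCharacters, §1] -/
theorem index_comap_alternatingGroup_eq_two :
    ((alternatingGroup (OddChar 2)).comap (oddCharAction (n := 2))).index = 2 := by
  rw [← commutator_eq_comap_alternatingGroup, SiegelModularGroupTwo.index_commutator_eq_two]

end ReinerK

end Literature.NumberTheory.ModularForms

end
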